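import Mathlib
import HarnessLib

/-!
# Route SelfMixingDichotomy — crux `SequentialTypeIExclusion` (S1, stmt-NavierStokesRegularity-1424), line `registered`,
# lead c6 (pulsating kinematic witness package): stub `pulse_arith` (W7)

Lands the registered stub `pulse_arith` of the lead's sub-skeleton `…SequentialTypeIExclusionPulsatingWitness`:
the pure real ARITHMETIC of the pulse train of the pulsating self-similar swirling eddy. Notation:
`sₘ = (2^{4m²})⁻¹` (the `m`-th pulse lives at `1 − t = s ∈ (sₘ/6, sₘ/3)`), window scale `wₙ = (2^{2n²} · 4)⁻¹`
(`wₙ² = sₙ/16`). Three clauses: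

* (a) a pulse `s ∈ (sₘ/6, sₘ/3)` inside the `n`-th window `s < sₙ/16` is a LATER pulse, `n < m`
  (otherwise `sₙ ≤ sₘ` and `sₘ/6 < s < sₙ/16 ≤ sₘ/16`);
* (b) on a later pulse the amplitude cube `8ᵐ` is below the window majorant `16 wₙ s^{−1/2}`:
  `s^{−1/2} ≥ 2^{2m²}` and `2^{3m + 2n²} ≤ 2^{2m² + 2}` for `n + 1 ≤ m`;
* (c) on every pulse `4ᵐ √s ≤ 1`: `√s ≤ 2^{−2m²}` and `2m ≤ 2m²`.

Mathlib only (`Real.sqrt`, `Real.rpow`, monotonicity of `2 ^ ·`). Nothing here closes the item (`--supports`).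
-/

noncomputable section

open Set

-- `Summit = Problem` for this summit; the tree lakefile sets `weak.linter.dupNamespace = false`.
set_option linter.dupNamespace false

namespace Summit.NavierStokesRegularity.NavierStokesRegularity.Theorems.SequentialTypeIExclusion.Registered

/-- `√(sₘ) = 2^{−2m²}`: the square root of `(2^{4m²})⁻¹` is `(2^{2m²})⁻¹`. -/
theorem pulse_arith_sqrt_inv (m : ℕ) :
    Real.sqrt (((2 : ℝ) ^ (4 * m ^ 2))⁻¹) = ((2 : ℝ) ^ (2 * m ^ 2))⁻¹ := by
  have h : (2 : ℝ) ^ (4 * m ^ 2) = ((2 : ℝ) ^ (2 * m ^ 2)) ^ 2 := by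
    rw [← pow_mul]
    congr 1
    ring
  rw [Real.sqrt_inv, h, Real.sqrt_sq (by positivity)]

/-- On the `m`-th pulse `s ∈ (sₘ/6, sₘ/3)` one has `√s ≤ 2^{−2m²}` (since `s ≤ sₘ`). -/
theorem pulse_arith_sqrt_le {m : ℕ} {s : ℝ}
    (hs : s ∈ Set.Ioo (((2 : ℝ) ^ (4 * m ^ 2))⁻¹ / 6) (((2 : ℝ) ^ (4 * m ^ 2))⁻¹ / 3)) :
    Real.sqrt s ≤ ((2 : ℝ) ^ (2 * m ^ 2))⁻¹ := by
  have hSpos : (0 : ℝ) < ((2 : ℝ) ^ (4 * m ^ 2))⁻¹ := by positivity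
  have hsS : s ≤ ((2 : ℝ) ^ (4 * m ^ 2))⁻¹ := by linarith [hs.2]
  rw [← pulse_arith_sqrt_inv]
  exact Real.sqrt_le_sqrt hsS

/-- The exponent bookkeeping of clause (b): `3m + 2n² ≤ 2m² + 2` whenever `n < m`
(write `m = n + k + 1`; the difference is `1 + n + k + 2k² + 4nk`). -/
theorem pulse_arith_exp {n m : ℕ} (h : n < m) : m * 3 + 2 * n ^ 2 ≤ 2 + 2 * m ^ 2 := by
  obtain ⟨k, rfl⟩ := Nat.exists_eq_add_of_lt h
  nlinarith [Nat.zero_le (n * k), Nat.zero_le (k ^ 2)]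

/-- **W7 — the arithmetic of the pulse train** (`sₘ = (2^{4m²})⁻¹`, window `wₙ = (2^{2n²} · 4)⁻¹`, `wₙ² = sₙ/16`):
(a) a pulse `s ∈ (sₘ/6, sₘ/3)` inside the `n`-th window `s < sₙ/16` is a LATER pulse, `n < m`;
(b) on a later pulse the amplitude cube `8ᵐ` is below the window majorant `16 wₙ s^{−1/2}`
(`s^{−1/2} > 2^{2m²}`, `2^{2m² − 2n² + 2} ≥ 2^{4m} ≥ 8ᵐ` for `n ≤ m − 1`);
(c) on every pulse `4ᵐ √s ≤ 1` (`√s < 2^{−2m²}`, `2m ≤ 2m²`; `m = 0`: `s < 1/3`). -/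
theorem pulse_arith :
    (∀ (n m : ℕ) (s : ℝ),
        s ∈ Set.Ioo (((2 : ℝ) ^ (4 * m ^ 2))⁻¹ / 6) (((2 : ℝ) ^ (4 * m ^ 2))⁻¹ / 3) →
        s < ((2 : ℝ) ^ (4 * n ^ 2))⁻¹ / 16 → n < m) ∧
    (∀ (n m : ℕ) (s : ℝ), n < m →
        s ∈ Set.Ioo (((2 : ℝ) ^ (4 * m ^ 2))⁻¹ / 6) (((2 : ℝ) ^ (4 * m ^ 2))⁻¹ / 3) →
        ((2 : ℝ) ^ m) ^ 3 ≤ 16 * ((2 : ℝ) ^ (2 * n ^ 2) * 4)⁻¹ * s ^ (-(1 / 2 : ℝ))) ∧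
    (∀ (m : ℕ) (s : ℝ),
        s ∈ Set.Ioo (((2 : ℝ) ^ (4 * m ^ 2))⁻¹ / 6) (((2 : ℝ) ^ (4 * m ^ 2))⁻¹ / 3) →
        ((2 : ℝ) ^ m) ^ 2 * Real.sqrt s ≤ 1) := by
  refine ⟨fun n m s hs hlt => ?_, fun n m s hnm hs => ?_, fun m s hs => ?_⟩
  · -- (a): if `m ≤ n` then `sₙ ≤ sₘ`, contradicting `sₘ/6 < s < sₙ/16`
    by_contra h
    have hmn : m ≤ n := not_lt.1 h
    have hpow : (2 : ℝ) ^ (4 * m ^ 2) ≤ (2 : ℝ) ^ (4 * n ^ 2) :=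
      pow_le_pow_right₀ (by norm_num) (Nat.mul_le_mul_left 4 (Nat.pow_le_pow_left hmn 2))
    have hinv : ((2 : ℝ) ^ (4 * n ^ 2))⁻¹ ≤ ((2 : ℝ) ^ (4 * m ^ 2))⁻¹ := inv_anti₀ (by positivity) hpow
    have hpos : (0 : ℝ) < ((2 : ℝ) ^ (4 * m ^ 2))⁻¹ := by positivity
    linarith [hs.1, hlt]
  · -- (b): `s^{-1/2} ≥ 2^{2m²}` and `2^{3m} · 2^{2n²} ≤ 4 · 2^{2m²}`
    have hspos : 0 < s := lt_trans (by positivity) hs.1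
    have hsqrt : Real.sqrt s ≤ ((2 : ℝ) ^ (2 * m ^ 2))⁻¹ := pulse_arith_sqrt_le hs
    have hX : (2 : ℝ) ^ (2 * m ^ 2) ≤ s ^ (-(1 / 2 : ℝ)) := by
      rw [Real.rpow_neg hspos.le, ← Real.sqrt_eq_rpow]
      have := inv_anti₀ (Real.sqrt_pos.2 hspos) hsqrt
      rwa [inv_inv] at this
    have hkey : ((2 : ℝ) ^ m) ^ 3 * (2 : ℝ) ^ (2 * n ^ 2) ≤ 4 * (2 : ℝ) ^ (2 * m ^ 2) := by
      rw [← pow_mul, ← pow_add, show (4 : ℝ) = 2 ^ 2 by norm_num, ← pow_add]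
      exact pow_le_pow_right₀ (by norm_num) (pulse_arith_exp hnm)
    calc ((2 : ℝ) ^ m) ^ 3 ≤ 4 * (2 : ℝ) ^ (2 * m ^ 2) / (2 : ℝ) ^ (2 * n ^ 2) := by
          rw [le_div_iff₀ (by positivity)]
          exact hkey
      _ = 16 * ((2 : ℝ) ^ (2 * n ^ 2) * 4)⁻¹ * (2 : ℝ) ^ (2 * m ^ 2) := by
          field_simp
          ring
      _ ≤ 16 * ((2 : ℝ) ^ (2 * n ^ 2) * 4)⁻¹ * s ^ (-(1 / 2 : ℝ)) := by gcongr
  · -- (c): `(2^m)^2 ≤ 2^{2m²}` and `√s ≤ 2^{-2m²}`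
    have h1 : ((2 : ℝ) ^ m) ^ 2 ≤ (2 : ℝ) ^ (2 * m ^ 2) := by
      rw [← pow_mul]
      exact pow_le_pow_right₀ (by norm_num) (by linarith [Nat.le_self_pow two_ne_zero m])
    have h2 : Real.sqrt s ≤ ((2 : ℝ) ^ (2 * m ^ 2))⁻¹ := pulse_arith_sqrt_le hs
    calc ((2 : ℝ) ^ m) ^ 2 * Real.sqrt s ≤ (2 : ℝ) ^ (2 * m ^ 2) * ((2 : ℝ) ^ (2 * m ^ 2))⁻¹ :=
          mul_le_mul h1 h2 (Real.sqrt_nonneg _) (by positivity)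
      _ = 1 := mul_inv_cancel₀ (by positivity)

end Summit.NavierStokesRegularity.NavierStokesRegularity.Theorems.SequentialTypeIExclusion.Registered

end
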